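import Mathlib
import Summits.ValiantsHypothesis.ValiantsHypothesis.Theorems.ValuativeGCTValuativeFlipPencilEvalCheck
import Summits.ValiantsHypothesis.ValiantsHypothesis.Theorems.ValuativeGCTValuativeFlipHeadCensusPointwise

/-!
# Certified small case `N = 10`: the four-row census FLIPS at `(n, m) = (10, 11)`, above the bottom

Helper file (`--supports stmt-ValiantsHypothesis-12624`, computational lane: one `native_decide`) for
crux `ValuativeGCT.ValuativeFlip`, line `four-row-count`, wall-breaker axis k14 "small cases certified".

* `pencilCheck_nine` — the evaluation certificate of
  `Theorems/ValuativeGCTValuativeFlipPencilEvalCheck.lean` at inner size `N = 10` (`n = 9`, `P = 302`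
  points, `r = 286`) evaluates to `true` (`native_decide`; ≈ 6–7 min in the interpreter: 302 × 10 subset
  DPs of depth 10, Gaussian elimination of a `400 × 302` matrix and a `286 × 286` inverse modulo
  `1000003`, product check);
* `pencilRank_ten` — hence `286 = C(13,3) ≤ dim span{X_t · (∂_{kl} per_10)(M·X)}` for the integer
  pencil `M = pencilZ 9`: the four-variable pencil family of `per_10` spans ALL quaternary forms of
  degree `10` (`le_finrank_of_pencilCheck`);
* `fourRow_census_ten_eleven`, `flipBody_ten_eleven`, `detObstruction_ten_eleven` — since
  `2·11² + 11 + 2 = 255 ≤ 286`, the pointwise head census (`headFlipBody_of_pencilCert_at` of `…HeadOfPencilCertificate.lean`,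
  `fourRow_*_of_pencilRank` of `…HeadCensusPointwise.lean`) gives at `(n, m) = (10, 11)`:
  a four-row shape `λ ⊢ 11δ` with `dim (Hom_{11δ} ⊓ SAND ⊓ HWSP(λ*)) < mult_{λ*} ℂ[Δ_11(X₀₀ per_10)]`, the
  body of the crux `ValuativeGCT.ValuativeFlip` at `(10, 11)` (centre `U = ⊥`), and a Mulmuley–Sohoni
  multiplicity obstruction `mult_{λ*} ℂ[Δ(det_11)] < mult_{λ*} ℂ[Δ_11(X₀₀ · per_10)]` on a four-row shape —
  the second certified position above the bottom (after `(9, 10)`, file `…PencilEvalCertificateN9.lean`);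
  `(10, 12)` is out of reach of the crude constants (`2·12²+12+2 = 302 > 286`).
[this crux's line four-row-count; Mulmuley–Sohoni 2008; BLMW 2011 §5.2] [folklore]
-/

set_option linter.dupNamespace false
set_option maxHeartbeats 800000

namespace Summit.ValiantsHypothesis.ValiantsHypothesis.Theorems.ValuativeFlip

open MvPolynomial
open scoped BigOperators Matrix
open Literature.NumberTheory.DiophantineGeometry
open Literature.Computability.AlgebraicComplexity

/-- **The certificate at `N = 10` checks** (`n = 9`, `302` points, rank `286`). [compute: native_decide,
in-file] [folklore] -/
theorem pencilCheck_nine : pencilCheck 9 302 286 = true := by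
  native_decide

/-- **Rank 286 at inner size 10**: the pencil family `X_t · (∂_{kl} per_10)(M·X)` of the integer pencil
`M = pencilZ 9` spans `≥ 286 = C(13,3)` dimensions, i.e. all quaternary forms of degree `10`.
[this crux's line four-row-count (generic value `min(C(n+3,3), 4n²-2n+2)`); folklore] -/
theorem pencilRank_ten :
    286 ≤ Module.finrank ℂ ↥(Submodule.span ℂ (Set.range fun tc : Fin 4 × (Fin 10 × Fin 10) =>
      (X tc.1 : MvPolynomial (Fin 4) ℂ) *
        aeval (fun ij : Fin 10 × Fin 10 =>
          ∑ t : Fin 4, (fun ij t => ((pencilZ 9 ij t : ℤ) : ℂ)) ij t • (X t : MvPolynomial (Fin 4) ℂ))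
          (pderiv tc.2 (perPoly (Fin 10) ℂ)))) :=
  le_finrank_of_pencilCheck 9 302 286 pencilCheck_nine

/-- **The four-row census flips at `(n, m) = (10, 11)`**: some `λ ⊢ 11δ` with at most four rows has
`dim (Hom_{11δ} ⊓ SAND ⊓ HWSP(λ*)) < mult_{λ*} ℂ[Δ_11(X₀₀ · per_10)]`. [this crux's line four-row-count;
folklore] -/
theorem fourRow_census_ten_eleven :
    ∃ (δ : ℕ) (lam : Nat.Partition (11 * δ)), lam.parts.card ≤ 4 ∧
        Module.finrank ℂ ↥(MvPolynomial.homogeneousSubmodule (MatIdx 11 × MatIdx 11) ℂ (11 * δ) ⊓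
          (⨅ (P : Matrix (Fin 11) (Fin 11) ℂ) (Q : Matrix (Fin 11) (Fin 11) ℂ) (_ : P.det = 1) (_ : Q.det = 1), LinearMap.ker ((MvPolynomial.aeval fun p : MatIdx 11 × MatIdx 11 => ∑ l : MatIdx 11, (P (ofLex p.2).1 (ofLex l).1 * Q (ofLex l).2 (ofLex p.2).2) • (MvPolynomial.X (p.1, l) : MvPolynomial (MatIdx 11 × MatIdx 11) ℂ)).toLinearMap - (LinearMap.id : MvPolynomial (MatIdx 11 × MatIdx 11) ℂ →ₗ[ℂ] MvPolynomial (MatIdx 11 × MatIdx 11) ℂ))) ⊓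
          (⨅ (g : Matrix.GeneralLinearGroup (MatIdx 11) ℂ) (_ : IsUpperTriangular g), LinearMap.ker ((MvPolynomial.aeval fun p : MatIdx 11 × MatIdx 11 => ∑ l : MatIdx 11, ((g⁻¹ : Matrix.GeneralLinearGroup (MatIdx 11) ℂ) : Matrix (MatIdx 11) (MatIdx 11) ℂ) p.1 l • (MvPolynomial.X (l, p.2) : MvPolynomial (MatIdx 11 × MatIdx 11) ℂ)).toLinearMap - weightChar ((Weight.dualOfPartition (11 * 11) lam).toMatIdx : Weight (MatIdx 11)) g • (LinearMap.id : MvPolynomial (MatIdx 11 × MatIdx 11) ℂ →ₗ[ℂ] MvPolynomial (MatIdx 11 × MatIdx 11) ℂ)))) <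
        orbitMultiplicity ℂ (paddedPerFormLex ℂ 10 11) 11 ((Weight.dualOfPartition (11 * 11) lam).toMatIdx : Weight (MatIdx 11)) :=
  fourRow_census_of_pencilRank 10 11 (by norm_num) (by norm_num) (fun ij t => ((pencilZ 9 ij t : ℤ) : ℂ))
    (fun t' : Fin 4 => ((0 : Fin (9 + 1)), Fin.castLE (by norm_num) t')) (pencilZ_cells_isUnit 9 (by norm_num))
    (le_trans (by norm_num) pencilRank_ten)

/-- **The crux body at `(10, 11)`**: the body of `ValuativeGCT.ValuativeFlip` (verbatim `let χ`, `let T`)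
holds at `n = 10`, `m = 11` — a valuative flip above the bottom of the window, certified. [this crux's
line four-row-count; folklore] -/
theorem flipBody_ten_eleven :
    ∃ (U : Submodule ℂ (MatIdx 11 → ℂ)) (r δ : ℕ) (lam : Nat.Partition (11 * δ)), (∀ u ∈ U, (Matrix.of fun a b : Fin 11 => u (toLex (a, b))).rank ≤ r) ∧ lam.parts.card ≤ 11 * 11 ∧ (let χ : Weight (MatIdx 11) := (Weight.dualOfPartition (11 * 11) lam).toMatIdx; let T : Submodule ℂ (MvPolynomial (MatIdx 11 × MatIdx 11) ℂ) := MvPolynomial.homogeneousSubmodule (MatIdx 11 × MatIdx 11) ℂ (11 * δ) ⊓ ((MvPolynomial.vanishingIdeal ℂ {p : MatIdx 11 × MatIdx 11 → ℂ | ∀ j : MatIdx 11, (fun i => p (j, i)) ∈ U}) ^ (δ * (11 - r))).restrictScalars ℂ ⊓ (⨅ (M : Matrix (MatIdx 11) (MatIdx 11) ℂ) (_ : linSubst (MatIdx 11) ℂ M (detFormLex ℂ 11) = detFormLex ℂ 11), LinearMap.ker ((MvPolynomial.aeval (R := ℂ) fun p : MatIdx 11 × MatIdx 11 => ∑ l :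 MatIdx 11, M l p.2 • MvPolynomial.X (p.1, l)).toLinearMap - LinearMap.id (R := ℂ) (M := MvPolynomial (MatIdx 11 × MatIdx 11) ℂ))) ⊓ (⨅ (g : Matrix.GeneralLinearGroup (MatIdx 11) ℂ) (_ : IsUpperTriangular g), LinearMap.ker ((MvPolynomial.aeval (R := ℂ) fun p : MatIdx 11 × MatIdx 11 => ∑ l : MatIdx 11, ((g⁻¹ : Matrix.GeneralLinearGroup (MatIdx 11) ℂ) : Matrix (MatIdx 11) (MatIdx 11) ℂ) p.1 l • MvPolynomial.X (l, p.2)).toLinearMap - weightChar χ g • LinearMap.id (R := ℂ) (M := MvPolynomial (MatIdx 11 × MatIdx 11) ℂ))); Module.finrank ℂ ↥T < orbitMultiplicity ℂ (paddedPerFormLex ℂ 10 11) 11 χ) :=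
  headFlipBody_of_pencilCert_at 10 11 (by norm_num) (by norm_num) (fun ij t => ((pencilZ 9 ij t : ℤ) : ℂ))
    (fun t' : Fin 4 => ((0 : Fin (9 + 1)), Fin.castLE (by norm_num) t')) (pencilZ_cells_isUnit 9 (by norm_num))
    (le_trans (by norm_num) pencilRank_ten)

/-- **A multiplicity obstruction at `(10, 11)`**: some four-row `λ ⊢ 11δ` has
`mult_{λ*} ℂ[Δ(det_11)] < mult_{λ*} ℂ[Δ_11(X₀₀ · per_10)]` — a Mulmuley–Sohoni multiplicity obstruction for
the determinant versus the padded permanent above the bottom of the window, certified.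
[Mulmuley–Sohoni 2008; BLMW 2011 §5.2; this crux's line four-row-count] [folklore] -/
theorem detObstruction_ten_eleven :
    ∃ (δ : ℕ) (lam : Nat.Partition (11 * δ)), lam.parts.card ≤ 4 ∧
      orbitMultiplicity ℂ (detFormLex ℂ 11) 11 ((Weight.dualOfPartition (11 * 11) lam).toMatIdx : Weight (MatIdx 11)) <
        orbitMultiplicity ℂ (paddedPerFormLex ℂ 10 11) 11 ((Weight.dualOfPartition (11 * 11) lam).toMatIdx : Weight (MatIdx 11)) :=
  fourRow_detObstruction_of_pencilRank 10 11 (by norm_num) (by norm_num) (fun ij t => ((pencilZ 9 ij t : ℤ) : ℂ))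
    (fun t' : Fin 4 => ((0 : Fin (9 + 1)), Fin.castLE (by norm_num) t')) (pencilZ_cells_isUnit 9 (by norm_num))
    (le_trans (by norm_num) pencilRank_ten)

end Summit.ValiantsHypothesis.ValiantsHypothesis.Theorems.ValuativeFlip
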